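import Mathlib

/-!
# Scheffé–Vitali without fibres: `L¹` convergence of a uniformly integrable sequence of densities to its conditional
# expectation times a fibre-normalised limit profile (helper file for `AveragedSpecificationLimit`, route
# SpecificationCompactness, support r9, stmt-QuantumFields-28252)

Abstract measure theory over Mathlib's `condExp`.  Setting: a probability law `π`, a sub-σ-algebra `m ≤ m0`, integrable densities `u_K ≥ 0`,
a bounded profile `0 ≤ q ≤ Q` with `π[q|m] = 1` a.e.

**THEOREM** (`tendsto_integral_abs_sub_condExp_mul`).  If the ratios `u_K/π[u_K|m] → q` π-a.e. and the `u_K` are uniformly integrable in the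
de la Vallée-Poussin form `∫ (u_K − M)₊ dπ ≤ ε` (`K ≥ K₀`), then `∫ |u_K − π[u_K|m]·q| dπ → 0`.

Proof: `∫ π[u_K|m]·q dπ = ∫ π[u_K|m]·π[q|m] dπ = ∫ u_K dπ`, so `∫ |u_K − π[u_K|m] q| = 2 ∫ (π[u_K|m] q − u_K)₊`; a.e.
`(π[u_K|m] q − u_K)₊ = π[u_K|m]·(q − u_K/π[u_K|m])₊` (on `{π[u_K|m] = 0}` the density `u_K` vanishes a.e.), the second factor is `≤ Q` and
tends to `0` a.e., and `π[u_K|m]` is uniformly integrable because `u_K` is (`(π[u|m] − M)₊ ≤ π[(u − M)₊|m]`): split at level `M`.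
This replaces «Scheffé on each fibre + Vitali» of the planner's sketch by a global argument ([Georgii2011] Thm 4.17 /
[FriedliVelenik2017] Lemma 6.27 pattern).  Rung R3 RECORD line; nothing here is specific to Yang–Mills (nothing about the YM mass gap).
-/

noncomputable section

namespace Summit.QuantumFields.YangMills.Theorems.SpecificationCompactnessKernel

open MeasureTheory Filter Topology

variable {X : Type*} {m m0 : MeasurableSpace X} {π : Measure X}

/-! ## §1 Scalar and bookkeeping lemmas -/

/-- `|a − b| = (a − b) + 2·(b − a)₊`. [folklore] -/
theorem abs_sub_eq_sub_add_two_mul_max (a b : ℝ) : |a - b| = (a - b) + 2 * max (b - a) 0 := by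
  rcases le_total a b with h | h
  · rw [abs_of_nonpos (sub_nonpos.mpr h), max_eq_left (sub_nonneg.mpr h)]; ring
  · rw [abs_of_nonneg (sub_nonneg.mpr h), max_eq_right (sub_nonpos.mpr h)]; ring

/-- For `0 ≤ φ ≤ Q`: `c·φ ≤ Q·(c − M)₊ + M·φ` (split at level `M`). [folklore] -/
theorem mul_le_max_add {c φ Q M : ℝ} (hφ0 : 0 ≤ φ) (hφQ : φ ≤ Q) :
    c * φ ≤ Q * max (c - M) 0 + M * φ := by
  rcases le_total c M with h | h
  · rw [max_eq_right (sub_nonpos.mpr h)]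
    nlinarith
  · rw [max_eq_left (sub_nonneg.mpr h)]
    nlinarith

/-- `h·g` is integrable for `g` integrable and `h` bounded a.e.-strongly measurable (local helper). [folklore] -/
private theorem integrable_bdd_mul_left' {g h : X → ℝ} (hg : Integrable g π) (hh : AEStronglyMeasurable h π) {C : ℝ}
    (hC : ∀ x, |h x| ≤ C) : Integrable (fun x => h x * g x) π :=
  hg.bdd_mul hh (Eventually.of_forall fun x => by rw [Real.norm_eq_abs]; exact hC x)

/-- **WHERE THE CONDITIONAL EXPECTATION OF A NON-NEGATIVE DENSITY VANISHES, THE DENSITY VANISHES A.E.** [folklore] -/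
theorem ae_eq_zero_of_condExp_eq_zero (hm : m ≤ m0) [IsFiniteMeasure π] {u : X → ℝ} (hu0 : ∀ x, 0 ≤ u x)
    (hui : Integrable u π) : ∀ᵐ x ∂π, π[u|m] x = 0 → u x = 0 := by
  have hcm : Measurable[m] (π[u|m]) := stronglyMeasurable_condExp.measurable
  have hS : MeasurableSet[m] (π[u|m] ⁻¹' {0}) := hcm (measurableSet_singleton 0)
  have hint : ∫ x in π[u|m] ⁻¹' {0}, u x ∂π = 0 := by
    rw [← setIntegral_condExp hm hui hS]
    exact setIntegral_eq_zero_of_forall_eq_zero fun x hx => hx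
  have hae : u =ᵐ[π.restrict (π[u|m] ⁻¹' {0})] 0 :=
    (setIntegral_eq_zero_iff_of_nonneg_ae (Eventually.of_forall hu0) hui.integrableOn).mp hint
  exact (ae_restrict_iff' (hm _ hS)).mp hae

/-- `∫ π[u|m]·q dπ = ∫ u dπ` when `π[q|m] = 1` a.e. (`q` bounded measurable). [folklore] -/
theorem integral_condExp_mul_eq_of_condExp_eq_one (hm : m ≤ m0) [IsFiniteMeasure π] {u q : X → ℝ}
    (hq : Measurable q) {Q : ℝ} (hqQ : ∀ x, |q x| ≤ Q) (hq1 : ∀ᵐ x ∂π, π[q|m] x = 1) :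
    ∫ x, π[u|m] x * q x ∂π = ∫ x, u x ∂π := by
  have hcm : StronglyMeasurable[m] (π[u|m]) := stronglyMeasurable_condExp
  have hci : Integrable (π[u|m]) π := integrable_condExp
  have hqi : Integrable q π :=
    (integrable_const Q).mono' hq.aestronglyMeasurable (Eventually.of_forall fun x => by
      rw [Real.norm_eq_abs]; exact hqQ x)
  -- pull-out: ∫ π[u|m]·π[q|m] = ∫ π[u|m]·q
  have hkg : Integrable (π[u|m] * q) π := by
    have := integrable_bdd_mul_left' hci hq.aestronglyMeasurable hqQ
    exact this.congr (Eventually.of_forall fun x => by show q x * π[u|m] x = (π[u|m] * q) x; simp [mul_comm])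
  have h1 : π[π[u|m] * q|m] =ᵐ[π] π[u|m] * π[q|m] := condExp_mul_of_stronglyMeasurable_left hcm hkg hqi
  calc ∫ x, π[u|m] x * q x ∂π = ∫ x, (π[u|m] * q) x ∂π := rfl
    _ = ∫ x, π[π[u|m] * q|m] x ∂π := (integral_condExp hm).symm
    _ = ∫ x, (π[u|m] * π[q|m]) x ∂π := integral_congr_ae h1
    _ = ∫ x, π[u|m] x ∂π := integral_congr_ae (hq1.mono fun x hx => by
        show π[u|m] x * π[q|m] x = π[u|m] x; rw [hx, mul_one])
    _ = ∫ x, u x ∂π := integral_condExp hm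

/-- **UNIFORM INTEGRABILITY PASSES TO CONDITIONAL EXPECTATIONS**: `∫ (π[u|m] − M)₊ dπ ≤ ∫ (u − M)₊ dπ`. [folklore] -/
theorem integral_max_condExp_sub_le (hm : m ≤ m0) [IsFiniteMeasure π] {u : X → ℝ} (hui : Integrable u π) (M : ℝ) :
    ∫ x, max (π[u|m] x - M) 0 ∂π ≤ ∫ x, max (u x - M) 0 ∂π := by
  have hsub : Integrable (fun x => u x - M) π := hui.sub (integrable_const M)
  have hpos : Integrable (fun x => max (u x - M) 0) π := hsub.pos_part
  have h1 : π[fun x => u x - M|m] =ᵐ[π] fun x => π[u|m] x - M := by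
    have h := condExp_sub hui (integrable_const M) m
    have hc : π[fun _ : X => M|m] = fun _ => M := condExp_const hm M
    filter_upwards [h] with x hx
    have : π[(u - fun _ => M)|m] x = (π[u|m] - π[fun _ : X => M|m]) x := hx
    rw [hc] at this
    exact this
  have h2 : π[fun x => u x - M|m] ≤ᵐ[π] π[fun x => max (u x - M) 0|m] :=
    condExp_mono hsub hpos (Eventually.of_forall fun x => le_max_left _ _)
  have h3 : (0 : X → ℝ) ≤ᵐ[π] π[fun x => max (u x - M) 0|m] :=
    condExp_nonneg (Eventually.of_forall fun x => le_max_right _ _)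
  have h4 : (fun x => max (π[u|m] x - M) 0) ≤ᵐ[π] π[fun x => max (u x - M) 0|m] := by
    filter_upwards [h1, h2, h3] with x hx1 hx2 hx3
    rw [← hx1]
    exact max_le hx2 hx3
  calc ∫ x, max (π[u|m] x - M) 0 ∂π ≤ ∫ x, π[fun x => max (u x - M) 0|m] x ∂π :=
        integral_mono_ae ((integrable_condExp (f := u)).sub (integrable_const M)).pos_part integrable_condExp h4
    _ = ∫ x, max (u x - M) 0 ∂π := integral_condExp hm

/-! ## §2 The theorem -/

/-- **SCHEFFÉ–VITALI WITHOUT FIBRES.**  `π` a probability law, `m ≤ m0`; integrable densities `u_K ≥ 0`; a measurable profile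
`0 ≤ q ≤ Q` with `π[q|m] = 1` a.e.; the ratios `u_K/π[u_K|m] → q` π-a.e.; the `u_K` uniformly integrable (`∫ (u_K − M)₊ ≤ ε` for `K ≥ K₀`).
Then `∫ |u_K − π[u_K|m]·q| dπ → 0`. [folklore] -/
theorem tendsto_integral_abs_sub_condExp_mul (hm : m ≤ m0) [IsProbabilityMeasure π]
    {u : ℕ → X → ℝ} (hu : ∀ K, Measurable (u K)) (hu0 : ∀ K x, 0 ≤ u K x) (hui : ∀ K, Integrable (u K) π)
    {q : X → ℝ} (hq : Measurable q) (hq0 : ∀ x, 0 ≤ q x) {Q : ℝ} (hqQ : ∀ x, q x ≤ Q)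
    (hq1 : ∀ᵐ x ∂π, π[q|m] x = 1)
    (hlim : ∀ᵐ x ∂π, Tendsto (fun K => u K x / π[u K|m] x) atTop (𝓝 (q x)))
    (hUI : ∀ ε : ℝ, 0 < ε → ∃ (M : ℝ) (K₀ : ℕ), ∀ K, K₀ ≤ K → ∫ x, max (u K x - M) 0 ∂π ≤ ε) :
    Tendsto (fun K => ∫ x, |u K x - π[u K|m] x * q x| ∂π) atTop (𝓝 0) := by
  -- notation and standing facts
  have hqabs : ∀ x, |q x| ≤ Q := fun x => by rw [abs_of_nonneg (hq0 x)]; exact hqQ x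
  have hcm : ∀ K, StronglyMeasurable[m] (π[u K|m]) := fun K => stronglyMeasurable_condExp
  have hcm0 : ∀ K, Measurable (π[u K|m]) := fun K => ((hcm K).mono hm).measurable
  have hci : ∀ K, Integrable (π[u K|m]) π := fun K => integrable_condExp
  have hc0 : ∀ K, ∀ᵐ x ∂π, 0 ≤ π[u K|m] x := fun K => condExp_nonneg (Eventually.of_forall (hu0 K))
  have hcz : ∀ K, ∀ᵐ x ∂π, π[u K|m] x = 0 → u K x = 0 := fun K => ae_eq_zero_of_condExp_eq_zero hm (hu0 K) (hui K)
  -- the positive-part function φ_K := (q − u_K/π[u_K|m])₊, bounded by Q a.e., tending to 0 a.e.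
  set φ : ℕ → X → ℝ := fun K x => max (q x - u K x / π[u K|m] x) 0 with hφ
  have hφm : ∀ K, Measurable (φ K) := fun K => (hq.sub ((hu K).div (hcm0 K))).max measurable_const
  have hφ0 : ∀ K x, 0 ≤ φ K x := fun K x => le_max_right _ _
  have hφQ : ∀ K, ∀ᵐ x ∂π, φ K x ≤ Q := fun K => (hc0 K).mono fun x hx => by
    refine max_le ?_ ((hq0 x).trans (hqQ x))
    have : 0 ≤ u K x / π[u K|m] x := div_nonneg (hu0 K x) hx
    linarith [hqQ x]
  have hφlim : ∀ᵐ x ∂π, Tendsto (fun K => φ K x) atTop (𝓝 0) := hlim.mono fun x hx => by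
    have h := ((tendsto_const_nhds (x := q x)).sub hx).max (tendsto_const_nhds (x := (0 : ℝ)))
    simpa [hφ] using h
  have hφint : Tendsto (fun K => ∫ x, φ K x ∂π) atTop (𝓝 0) := by
    have h := tendsto_integral_of_dominated_convergence (μ := π) (F := fun K x => φ K x) (f := fun _ => (0 : ℝ))
      (fun _ => Q) (fun K => (hφm K).aestronglyMeasurable) (integrable_const Q)
      (fun K => (hφQ K).mono fun x hx => by rw [Real.norm_eq_abs, abs_of_nonneg (hφ0 K x)]; exact hx) hφlim
    simpa using h
  -- (1) the key a.e. identity: (π[u_K|m] q − u_K)₊ = π[u_K|m]·φ_K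
  have hident : ∀ K, ∀ᵐ x ∂π, max (π[u K|m] x * q x - u K x) 0 = π[u K|m] x * φ K x := fun K => by
    filter_upwards [hc0 K, hcz K] with x hx0 hxz
    rcases hx0.lt_or_eq with hpos | hzero
    · have hu_eq : u K x = π[u K|m] x * (u K x / π[u K|m] x) := by field_simp
      simp only [hφ]
      rw [mul_max_of_nonneg _ _ hx0, mul_zero, mul_sub, ← hu_eq]
    · rw [← hzero, hxz hzero.symm]; simp
  -- (2) the L¹ distance is twice the positive part
  have hL1 : ∀ K, ∫ x, |u K x - π[u K|m] x * q x| ∂π = 2 * ∫ x, π[u K|m] x * φ K x ∂π := fun K => by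
    have hcq : Integrable (fun x => π[u K|m] x * q x) π := by
      have := integrable_bdd_mul_left' (hci K) hq.aestronglyMeasurable hqabs
      exact this.congr (Eventually.of_forall fun x => by show q x * π[u K|m] x = π[u K|m] x * q x; ring)
    have hdiff : Integrable (fun x => u K x - π[u K|m] x * q x) π := (hui K).sub hcq
    have hposi : Integrable (fun x => max (π[u K|m] x * q x - u K x) 0) π := (hcq.sub (hui K)).pos_part
    have h1 : ∫ x, |u K x - π[u K|m] x * q x| ∂π =
        ∫ x, (u K x - π[u K|m] x * q x) + 2 * max (π[u K|m] x * q x - u K x) 0 ∂π :=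
      integral_congr_ae (Eventually.of_forall fun x => abs_sub_eq_sub_add_two_mul_max _ _)
    rw [h1, integral_add hdiff (hposi.const_mul 2), integral_sub (hui K) hcq, integral_const_mul,
      integral_condExp_mul_eq_of_condExp_eq_one hm hq hqabs hq1, sub_self, zero_add]
    congr 1
    exact integral_congr_ae (hident K)
  -- (3) ε-assembly
  rw [Metric.tendsto_atTop]
  intro η hη
  have hQ1 : 0 < max Q 1 + 1 := by positivity
  obtain ⟨M, K₀, hM⟩ := hUI (η / (8 * (max Q 1 + 1))) (by positivity)
  -- WLOG `M ≥ 0`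
  set M' : ℝ := max M 0 with hM'
  have hM'0 : 0 ≤ M' := le_max_right _ _
  have hM'le : ∀ K, K₀ ≤ K → ∫ x, max (u K x - M') 0 ∂π ≤ η / (8 * (max Q 1 + 1)) := fun K hK => by
    refine le_trans (integral_mono_of_nonneg (Eventually.of_forall fun x => le_max_right _ _)
      (((hui K).sub (integrable_const M)).pos_part) (Eventually.of_forall fun x => ?_)) (hM K hK)
    exact max_le_max (sub_le_sub_left (le_max_left M 0) _) le_rfl
  obtain ⟨K₁, hK₁⟩ := (Metric.tendsto_atTop.mp hφint) (η / (8 * (M' + 1))) (by positivity)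
  refine ⟨max K₀ K₁, fun K hK => ?_⟩
  have hK0 : K₀ ≤ K := le_of_max_le_left hK
  have hφK : ∫ x, φ K x ∂π < η / (8 * (M' + 1)) := by
    have := hK₁ K (le_of_max_le_right hK)
    rwa [dist_zero_right, Real.norm_eq_abs, abs_of_nonneg (integral_nonneg fun x => hφ0 K x)] at this
  -- ∫ π[u_K|m] φ_K ≤ (max Q 1)·∫(π[u_K|m] − M')₊ + M'·∫φ_K
  have hcφi : Integrable (fun x => π[u K|m] x * φ K x) π := by
    have hcq : Integrable (fun x => π[u K|m] x * q x) π := by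
      have := integrable_bdd_mul_left' (hci K) hq.aestronglyMeasurable hqabs
      exact this.congr (Eventually.of_forall fun x => by show q x * π[u K|m] x = π[u K|m] x * q x; ring)
    exact ((hcq.sub (hui K)).pos_part).congr (hident K)
  have hI1 : Integrable (fun x => max (π[u K|m] x - M') 0) π := ((hci K).sub (integrable_const M')).pos_part
  have hI2 : Integrable (fun x => φ K x) π :=
    (integrable_const Q).mono' (hφm K).aestronglyMeasurable ((hφQ K).mono fun x hx => by
      rw [Real.norm_eq_abs, abs_of_nonneg (hφ0 K x)]; exact hx)
  have hbound : ∫ x, π[u K|m] x * φ K x ∂π ≤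
      max Q 1 * ∫ x, max (π[u K|m] x - M') 0 ∂π + M' * ∫ x, φ K x ∂π := by
    have hrhs : Integrable (fun x => max Q 1 * max (π[u K|m] x - M') 0 + M' * φ K x) π :=
      (hI1.const_mul _).add (hI2.const_mul _)
    calc ∫ x, π[u K|m] x * φ K x ∂π ≤ ∫ x, max Q 1 * max (π[u K|m] x - M') 0 + M' * φ K x ∂π := by
          refine integral_mono_ae hcφi hrhs ?_
          filter_upwards [hφQ K] with x hxQ
          exact mul_le_max_add (hφ0 K x) (hxQ.trans (le_max_left _ _))
      _ = max Q 1 * ∫ x, max (π[u K|m] x - M') 0 ∂π + M' * ∫ x, φ K x ∂π := by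
          rw [integral_add (hI1.const_mul _) (hI2.const_mul _), integral_const_mul, integral_const_mul]
  have hUIc : ∫ x, max (π[u K|m] x - M') 0 ∂π ≤ η / (8 * (max Q 1 + 1)) :=
    (integral_max_condExp_sub_le hm (hui K) M').trans (hM'le K hK0)
  -- conclude
  rw [dist_zero_right, Real.norm_eq_abs, abs_of_nonneg (integral_nonneg fun x => abs_nonneg _), hL1 K]
  have h1 : max Q 1 * ∫ x, max (π[u K|m] x - M') 0 ∂π ≤ η / 8 := by
    calc max Q 1 * ∫ x, max (π[u K|m] x - M') 0 ∂π ≤ max Q 1 * (η / (8 * (max Q 1 + 1))) :=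
          mul_le_mul_of_nonneg_left hUIc (by positivity)
      _ ≤ η / 8 := by
          rw [mul_div_assoc']
          rw [div_le_div_iff₀ (by positivity) (by positivity)]
          nlinarith [le_max_right Q 1]
  have h2 : M' * ∫ x, φ K x ∂π ≤ η / 8 := by
    calc M' * ∫ x, φ K x ∂π ≤ M' * (η / (8 * (M' + 1))) := mul_le_mul_of_nonneg_left hφK.le hM'0
      _ ≤ η / 8 := by
          rw [mul_div_assoc']
          rw [div_le_div_iff₀ (by positivity) (by positivity)]
          nlinarith
  linarith [hbound, hη]

end Summit.QuantumFields.YangMills.Theorems.SpecificationCompactnessKernel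

end
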